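import Summits.BirchSwinnertonDyer.BirchSwinnertonDyer.Theorems.Rank2Observatory2DescClFieldCertE2Q2
import Summits.BirchSwinnertonDyer.BirchSwinnertonDyer.Theorems.Rank2Observatory2DescClOmegaElt
import Summits.BirchSwinnertonDyer.BirchSwinnertonDyer.Theorems.Rank2Observatory2DescPadicRootTriple
import HarnessLib

/-!
# BirchSwinnertonDyer — rank ≥ 2 observatory: KERNEL-2DESC-CL ΩD — the per-field record with a DYADIC ROOT VIEW (`ClFieldCertD`), part 2

HONEST FRAMING: per-curve certified theorems and census instruments; no claim on BSD in rank ≥ 2.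

The per-field record for a complex cubic 2-division field `K = ℚ(α)` with COMMON INDEX DIVISOR `2` (`2` totally
split, every element of `𝓞 K` of even index — `73` fields / `182` curves of the rank-2 census; no monogenic view
and no coprime two-view exists, so v2.0–E2Q2 cannot present them).  `ClFieldCertD` = `base : ClFieldCertQ2`
(the `α`-view two-auxiliary-prime record: its registry core `checkReg` — rows of ODD non-index primes, the four
primes `W₁₁ W₁₂ W₂₁ W₂₂`, the residue characters — is used; its one-view sweep is NOT) + a second algebraic
integer `ω = u(α)/d` (`etaCheck`, minimal polynomial `h`; elements of `𝓞 K` are `ω`-elements of part 1) + the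
DYADIC BLOCK: a `2`-adic precision `N`, three Hensel certificates `(aᵢ, dᵢ)` of the three `2`-adic roots of `g`
(`…2DescPadicRoot`), three separators `s ∈ P₁∖P₂`, `t ∈ P₁∖P₃`, `u ∈ P₂∖P₃` in `ω`-coordinates
(`…2DescPadicRootMem`, multiplier `d`), and three DYADIC CLASS CERTIFICATES `βᵢ ∈ Pᵢ`, `|N βᵢ| = 2·q₁^j·q₂^k`
(`ω`-coordinates; membership through the root view, norm through the `α`-avatar of `d·βᵢ`) + `ω`-type class
certificates of odd codes (`classRelQ` of E2Q2 part 3 on the avatar, multiplier `d`).  Consequences under the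
signature-free core `checkCoreD`: the three ROOTED PRIMES `Rᵢ : RootedPrime α 2 aᵢ N` exist
(`nonempty_rooted₁/₂/₃`), `(2) = P₁P₂P₃` and every prime above `2` is one of them (`cover₂_of_coreD`,
`…2DescPadicRootTriple.cover_of_triple`), each `Pᵢ` lies in `H_{q₁q₂}` (`classIn_dyadic`), and — the sweep
covering `2` by the dyadic block and every odd `p < bM` by `q₁`, `q₂` or an `α`-row, Minkowski against
`gcd(Δ(g), Δ(h))` — **the classes of the ideals containing `q₁·q₂` generate `Cl(K)`** (`closure_q2_eq_top_of_coreD`).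
`checkD = base.checkField ∧ checkCoreD`, run once per field by `decide +kernel`.
Sorry-free; new declarations only; axioms `propext`, `Classical.choice`, `Quot.sound`.
[cite: Cohen1993, §4.8.2, §6.1, §6.5] [cite: Marcus2018, Ch. 3, Thm. 27; Ch. 5, Thm. 35, Thm. 37 and Cor. 2]
[cite: Cassels1986, Ch. 4 (Hensel's lemma)]
-/

set_option linter.dupNamespace false

noncomputable section

open scoped Classical NumberField nonZeroDivisors

open Literature.NumberTheory.NumberFields Polynomial Module NumberField IsDedekindDomain Ideal

namespace Summit.BirchSwinnertonDyer.BirchSwinnertonDyer.Rank2Observatory.TwoDescCl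

open TwoDescCubic TwoDescPadic

variable {K : Type*} [Field K] [NumberField K] {θ : K}

/-! ## The record -/

/-- **One prime above `2` in the root view**: the Hensel datum `(ra, dd)` of a `2`-adic root `z ≡ ra (mod 2^N)` of
`g` (`dd = v₂(g′(ra))`), and a class certificate — the `ω`-coordinates `W` of an element `β ∈ P_z` with
`|N β| = 2 · q₁^j · q₂^k`, `jk = j + 64·k`. Pure data. -/
structure DyadicCert where
  /-- root approximation: `z ≡ ra (mod 2^N)` -/
  ra : ℤ
  /-- `v₂(g′(ra))` -/
  dd : ℕ
  /-- `ω`-coordinates of `β ∈ P` with `|N β| = 2·q₁^j·q₂^k` -/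
  W : ℤ × ℤ × ℤ
  /-- `j + 64·k` -/
  jk : ℕ

/-- **Per-field certificate with a dyadic root view** (complex cubic field of common index divisor `2`, two
auxiliary primes): the `α`-view Q2 record `base` (rows of odd non-index primes only; its sweep clause unused),
`ω = u(α)/d` with `X³ + a′X² + b′X + c′` its minimal polynomial and an irreducibility modulus, the `2`-adic
exponent `vd` used with the multiplier `d`, the precision `N`, the three dyadic primes, the three separators
(`ω`-coordinates) and the `ω`-type class certificates `(code, W, j + 64k)` of odd codes. Pure data.
[cite: Cohen1993, §6.1, §6.5] -/
structure ClFieldCertD where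
  /-- the `α`-view two-prime record (Q2) -/
  base : ClFieldCertQ2
  /-- `ω = (u₀ + u₁α + u₂α²)/d` -/
  u : ℤ × ℤ × ℤ
  /-- `ω = u(α)/d`, `0 < d` -/
  d : ℕ
  /-- the `2`-adic exponent used with the multiplier `d` in the dyadic certificates (`v₂(d)`) -/
  vd : ℕ
  /-- `h = X³ + a′X² + b′X + c′`, the minimal polynomial of `ω` -/
  a' : ℤ
  /-- `h` -/
  b' : ℤ
  /-- `h` -/
  c' : ℤ
  /-- a modulus modulo which `h` has no root -/
  pIrrW : ℕ
  /-- `2`-adic precision of the three roots -/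
  N : ℕ
  /-- the prime `P₁` above `2` -/
  P₁ : DyadicCert
  /-- the prime `P₂` above `2` -/
  P₂ : DyadicCert
  /-- the prime `P₃` above `2` -/
  P₃ : DyadicCert
  /-- `ω`-coordinates of `s ∈ P₁ ∖ P₂` -/
  sepS : ℤ × ℤ × ℤ
  /-- `ω`-coordinates of `t ∈ P₁ ∖ P₃` -/
  sepT : ℤ × ℤ × ℤ
  /-- `ω`-coordinates of `u ∈ P₂ ∖ P₃` -/
  sepU : ℤ × ℤ × ℤ
  /-- `ω`-type class certificates of odd codes: `(code, W, j + 64k)` -/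
  certsW : List (PCode × (ℤ × ℤ × ℤ) × ℕ)

namespace ClFieldCertD

variable (fd : ClFieldCertD)

/-! ## The checkers -/

/-- The `α`-avatar of `d·x` for the `ω`-coordinates `W`. -/
def av (W : ℤ × ℤ × ℤ) : ℤ × ℤ × ℤ := avatarD fd.u fd.d W

/-- Dyadic membership certificate `x ∈ P` (root `≡ ra`), multiplier `d`. Computable. -/
def dyMem (ra : ℤ) (W : ℤ × ℤ × ℤ) : Bool :=
  memCheck 2 ra fd.N (fd.d : ℤ) fd.vd (fd.av W).1 (fd.av W).2.1 (fd.av W).2.2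

/-- Dyadic non-membership certificate `x ∉ P` (root `≡ ra`), multiplier `d`. Computable. -/
def dyNotMem (ra : ℤ) (W : ℤ × ℤ × ℤ) : Bool :=
  notMemCheck 2 ra fd.N (fd.d : ℤ) fd.vd (fd.av W).1 (fd.av W).2.1 (fd.av W).2.2

/-- Dyadic class certificate of the prime `P`: `β ∈ P` and `|N(d·β)| = d³ · 2 · q₁^j · q₂^k`. Computable. -/
def dyClass (P : DyadicCert) : Bool :=
  fd.dyMem P.ra P.W &&
    decide ((normFormZ fd.base.a fd.base.b fd.base.c (fd.av P.W).1 (fd.av P.W).2.1 (fd.av P.W).2.2).natAbs =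
      fd.d ^ 3 * (2 * (fd.base.q₁ ^ (P.jk % 64) * fd.base.q₂ ^ (P.jk / 64))))

/-- **The dyadic block**: `ω` certificate and irreducibility of `h`, the three Hensel certificates, the three
separators, the three dyadic class certificates. Computable. [cite: Cassels1986, Ch. 4] -/
def checkDyadic : Bool :=
  etaCheck fd.base.a fd.base.b fd.base.c fd.u fd.d fd.a' fd.b' fd.c' && noRootMod fd.pIrrW fd.a' fd.b' fd.c' &&
    henselCheck fd.base.a fd.base.b fd.base.c 2 fd.P₁.ra fd.P₁.dd fd.N &&
    henselCheck fd.base.a fd.base.b fd.base.c 2 fd.P₂.ra fd.P₂.dd fd.N &&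
    henselCheck fd.base.a fd.base.b fd.base.c 2 fd.P₃.ra fd.P₃.dd fd.N &&
    (fd.dyMem fd.P₁.ra fd.sepS && fd.dyNotMem fd.P₂.ra fd.sepS) &&
    (fd.dyMem fd.P₁.ra fd.sepT && fd.dyNotMem fd.P₃.ra fd.sepT) &&
    (fd.dyMem fd.P₂.ra fd.sepU && fd.dyNotMem fd.P₃.ra fd.sepU) &&
    (fd.dyClass fd.P₁ && fd.dyClass fd.P₂ && fd.dyClass fd.P₃)

/-- `ω`-type class certificate of an odd code `C` (E2Q2 `classRelQ` on the avatar, multiplier `d`). Computable. -/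
def classRelW (C : PCode) (W : ℤ × ℤ × ℤ) (jk : ℕ) : Bool :=
  ClFieldCertEQ.classRelQ fd.base.a fd.base.b fd.base.c fd.d fd.base.q₁ fd.base.q₂ C (fd.av W) jk

/-- **The sweep**: Minkowski against `gcd(Δ(g), Δ(h))`; every `n < bM` is `< 2`, composite, `2` (the dyadic
block), `q₁`, `q₂`, or has an `α`-row; every code of every row in range has a class certificate (one-view
`classCheck₂` or `ω`-type). Computable. [cite: Marcus2018, Ch. 5, Cor. 2 to Thm. 35] -/
def checkSweepD : Bool :=
  decide (64 * (Int.gcd (MonicCubic.disc fd.base.a fd.base.b fd.base.c) (MonicCubic.disc fd.a' fd.b' fd.c') : ℤ) <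
      799 * (fd.base.bM : ℤ) ^ 2) &&
    ((List.range fd.base.bM).all fun n =>
      decide (n < 2) || ClFieldCert.smallFactor n || n == 2 || n == fd.base.q₁ || n == fd.base.q₂ ||
        fd.base.primes.any fun e => e.p == n) &&
    fd.base.primes.all fun e => decide (fd.base.bM ≤ e.p) ||
      e.codes.all fun C => (e.cls.any fun dd =>
        classCheck₂ fd.base.a fd.base.b fd.base.c fd.base.q₁ fd.base.q₂ fd.base.bM C dd) ||
        fd.certsW.any fun ce => ce.1 == C && fd.classRelW C ce.2.1 ce.2.2

/-- **The signature-free core**: registry core of `base`, the dyadic block, the sweep. Computable. -/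
def checkCoreD : Bool := fd.base.checkReg && fd.checkDyadic && fd.checkSweepD

/-- **The complex per-field checker with a dyadic root view.** Computable; `decide +kernel` once per field. -/
def checkD : Bool := fd.base.checkField && fd.checkCoreD

/-! ## Soundness: unpacking -/

/-- A passed `checkD` contains a passed base-field check `checkField`. -/
theorem checkField_of_checkD (h : fd.checkD = true) : fd.base.checkField = true := by
  simp only [checkD, Bool.and_eq_true] at h; exact h.1

/-- A passed `checkD` contains a passed core check `checkCoreD`. -/
theorem checkCoreD_of_checkD (h : fd.checkD = true) : fd.checkCoreD = true := by
  simp only [checkD, Bool.and_eq_true] at h; exact h.2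

/-- A passed `checkCoreD` contains a passed regulator/unit clause `checkReg` of the base certificate. -/
theorem checkReg_of_coreD (h : fd.checkCoreD = true) : fd.base.checkReg = true := by
  simp only [checkCoreD, Bool.and_eq_true] at h; exact h.1.1

/-- A passed `checkCoreD` contains a passed dyadic clause `checkDyadic`. -/
theorem checkDyadic_of_coreD (h : fd.checkCoreD = true) : fd.checkDyadic = true := by
  simp only [checkCoreD, Bool.and_eq_true] at h; exact h.1.2

/-- A passed `checkCoreD` contains a passed sweep clause `checkSweepD`. -/
theorem checkSweepD_of_coreD (h : fd.checkCoreD = true) : fd.checkSweepD = true := by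
  simp only [checkCoreD, Bool.and_eq_true] at h; exact h.2

/-- The dyadic block, unpacked. -/
theorem dyadic_of_coreD (h : fd.checkCoreD = true) :
    etaCheck fd.base.a fd.base.b fd.base.c fd.u fd.d fd.a' fd.b' fd.c' = true ∧
      noRootMod fd.pIrrW fd.a' fd.b' fd.c' = true ∧
      henselCheck fd.base.a fd.base.b fd.base.c 2 fd.P₁.ra fd.P₁.dd fd.N = true ∧
      henselCheck fd.base.a fd.base.b fd.base.c 2 fd.P₂.ra fd.P₂.dd fd.N = true ∧
      henselCheck fd.base.a fd.base.b fd.base.c 2 fd.P₃.ra fd.P₃.dd fd.N = true ∧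
      (fd.dyMem fd.P₁.ra fd.sepS = true ∧ fd.dyNotMem fd.P₂.ra fd.sepS = true) ∧
      (fd.dyMem fd.P₁.ra fd.sepT = true ∧ fd.dyNotMem fd.P₃.ra fd.sepT = true) ∧
      (fd.dyMem fd.P₂.ra fd.sepU = true ∧ fd.dyNotMem fd.P₃.ra fd.sepU = true) ∧
      (fd.dyClass fd.P₁ = true ∧ fd.dyClass fd.P₂ = true ∧ fd.dyClass fd.P₃ = true) := by
  have h' := fd.checkDyadic_of_coreD h
  simp only [checkDyadic, Bool.and_eq_true] at h'
  obtain ⟨⟨⟨⟨⟨⟨⟨⟨he, hi⟩, h₁⟩, h₂⟩, h₃⟩, hs⟩, ht⟩, hu⟩, ⟨hc₁, hc₂⟩, hc₃⟩ := h'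
  exact ⟨he, hi, h₁, h₂, h₃, hs, ht, hu, hc₁, hc₂, hc₃⟩

/-- `0 < d`. -/
theorem d_pos (h : fd.checkCoreD = true) : 0 < fd.d := pos_of_etaCheck (fd.dyadic_of_coreD h).1

/-- **`h(ω) = 0`.** [folklore] -/
theorem aeval_omega (hθ : aeval θ (MonicCubic.poly fd.base.a fd.base.b fd.base.c) = 0) (h : fd.checkCoreD = true) :
    aeval (eta θ fd.u fd.d) (MonicCubic.poly fd.a' fd.b' fd.c') = 0 :=
  aeval_eta_eq_zero hθ (fd.dyadic_of_coreD h).1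

/-- `h` is irreducible. [folklore] -/
theorem irreducibleW (h : fd.checkCoreD = true) : Irreducible (MonicCubic.polyQ fd.a' fd.b' fd.c') :=
  irreducible_of_noRootMod (fd.dyadic_of_coreD h).2.1

/-- `g` is irreducible (registry core). [folklore] -/
theorem irreducible_of_coreD (h : fd.checkCoreD = true) :
    Irreducible (MonicCubic.polyQ fd.base.a fd.base.b fd.base.c) :=
  fd.base.irreducible_of_reg (fd.checkReg_of_coreD h)

/-! ## The three rooted primes -/

/-- **The rooted prime `P₁` exists.** [cite: Cassels1986, Ch. 4] -/
theorem nonempty_rooted₁ (hθ : aeval θ (MonicCubic.poly fd.base.a fd.base.b fd.base.c) = 0) (h3 : finrank ℚ K = 3)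
    (h : fd.checkCoreD = true) : Nonempty (RootedPrime θ 2 fd.P₁.ra fd.N) :=
  nonempty_rootedPrime_of_henselCheck (fd.irreducible_of_coreD h) hθ h3 (fd.dyadic_of_coreD h).2.2.1

/-- **The rooted prime `P₂` exists.** [cite: Cassels1986, Ch. 4] -/
theorem nonempty_rooted₂ (hθ : aeval θ (MonicCubic.poly fd.base.a fd.base.b fd.base.c) = 0) (h3 : finrank ℚ K = 3)
    (h : fd.checkCoreD = true) : Nonempty (RootedPrime θ 2 fd.P₂.ra fd.N) :=
  nonempty_rootedPrime_of_henselCheck (fd.irreducible_of_coreD h) hθ h3 (fd.dyadic_of_coreD h).2.2.2.1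

/-- **The rooted prime `P₃` exists.** [cite: Cassels1986, Ch. 4] -/
theorem nonempty_rooted₃ (hθ : aeval θ (MonicCubic.poly fd.base.a fd.base.b fd.base.c) = 0) (h3 : finrank ℚ K = 3)
    (h : fd.checkCoreD = true) : Nonempty (RootedPrime θ 2 fd.P₃.ra fd.N) :=
  nonempty_rootedPrime_of_henselCheck (fd.irreducible_of_coreD h) hθ h3 (fd.dyadic_of_coreD h).2.2.2.2.1

variable {fd}

/-- Membership of an `ω`-element from a dyadic certificate (multiplier `d`). [folklore] -/
theorem mem_of_dyMem (hθ : aeval θ (MonicCubic.poly fd.base.a fd.base.b fd.base.c) = 0) (h : fd.checkCoreD = true)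
    {ra : ℤ} (R : RootedPrime θ 2 ra fd.N) {W : ℤ × ℤ × ℤ} (hc : fd.dyMem ra W = true) :
    omegaElt hθ (fd.aeval_omega hθ h) W ∈ primeOf R.φ :=
  R.mem hθ (intCast_mul_omegaElt_avatarD hθ (fd.d_pos h) (fd.aeval_omega hθ h) W) hc

/-- Non-membership of an `ω`-element from a dyadic certificate (multiplier `d`). [folklore] -/
theorem not_mem_of_dyNotMem (hθ : aeval θ (MonicCubic.poly fd.base.a fd.base.b fd.base.c) = 0)
    (h : fd.checkCoreD = true) {ra : ℤ} (R : RootedPrime θ 2 ra fd.N) {W : ℤ × ℤ × ℤ}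
    (hc : fd.dyNotMem ra W = true) : omegaElt hθ (fd.aeval_omega hθ h) W ∉ primeOf R.φ :=
  R.not_mem hθ (intCast_mul_omegaElt_avatarD hθ (fd.d_pos h) (fd.aeval_omega hθ h) W) hc

/-- **`(2) = P₁P₂P₃` and every prime above `2` is one of the three rooted primes.** [cite: Marcus2018, Ch. 3, Thm. 21] -/
theorem cover₂_of_coreD (hθ : aeval θ (MonicCubic.poly fd.base.a fd.base.b fd.base.c) = 0) (h3 : finrank ℚ K = 3)
    (h : fd.checkCoreD = true) (R₁ : RootedPrime θ 2 fd.P₁.ra fd.N) (R₂ : RootedPrime θ 2 fd.P₂.ra fd.N)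
    (R₃ : RootedPrime θ 2 fd.P₃.ra fd.N) :
    span {((2 : ℕ) : 𝓞 K)} = primeOf R₁.φ * primeOf R₂.φ * primeOf R₃.φ ∧
      ∀ w : HeightOneSpectrum (𝓞 K), ((2 : ℕ) : 𝓞 K) ∈ w.asIdeal → w = R₁.spec ∨ w = R₂.spec ∨ w = R₃.spec := by
  obtain ⟨-, -, -, -, -, ⟨hs₁, hs₂⟩, ⟨ht₁, ht₃⟩, ⟨hu₂, hu₃⟩, -⟩ := fd.dyadic_of_coreD h
  have hd := fd.d_pos h
  have hω := fd.aeval_omega hθ h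
  exact cover_of_triple hθ h3 R₁ R₂ R₃ (intCast_mul_omegaElt_avatarD hθ hd hω fd.sepS) hs₁ hs₂
    (intCast_mul_omegaElt_avatarD hθ hd hω fd.sepT) ht₁ ht₃ (intCast_mul_omegaElt_avatarD hθ hd hω fd.sepU) hu₂ hu₃

/-- **A dyadic class certificate puts its prime in `H_{q₁q₂}`.** [cite: Marcus2018, Ch. 5, Thm. 37] -/
theorem classIn_of_dyClass (hθ : aeval θ (MonicCubic.poly fd.base.a fd.base.b fd.base.c) = 0) (h3 : finrank ℚ K = 3)
    (h : fd.checkCoreD = true) (hpr : fd.base.primeList.Forall Nat.Prime) {P : DyadicCert}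
    (R : RootedPrime θ 2 P.ra fd.N) (hc : fd.dyClass P = true) :
    ClassIn (tsuppClosure (((fd.base.q₁ * fd.base.q₂ : ℕ) : ℕ) : 𝓞 K)) (primeOf R.φ) := by
  simp only [dyClass, Bool.and_eq_true, decide_eq_true_eq] at hc
  obtain ⟨hmem, hN⟩ := hc
  have hirr := fd.irreducible_of_coreD h
  have hd := fd.d_pos h
  have hω := fd.aeval_omega hθ h
  have hq₁ := fd.base.q₁_prime hpr
  have hq₂ := fd.base.q₂_prime hpr
  have hβ : omegaElt hθ hω P.W ∈ primeOf R.φ := mem_of_dyMem hθ h R hmem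
  have hm : 0 < fd.base.q₁ ^ (P.jk % 64) * fd.base.q₂ ^ (P.jk / 64) :=
    Nat.mul_pos (pow_pos hq₁.pos _) (pow_pos hq₂.pos _)
  have hn := natAbs_norm_omegaElt_mul hirr hθ h3 hd hω (omegaCheck_avatarD fd.u fd.d P.W)
  rw [show avatarD fd.u fd.d P.W = fd.av P.W from rfl, hN] at hn
  have hnorm : (Algebra.norm ℤ (omegaElt hθ hω P.W)).natAbs =
      absNorm (primeOf R.φ) * (fd.base.q₁ ^ (P.jk % 64) * fd.base.q₂ ^ (P.jk / 64)) := by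
    rw [R.absNorm_eq]
    exact Nat.eq_of_mul_eq_mul_left (pow_pos hd 3) hn
  exact ClassIn.of_mem_of_absNorm (primeOf_ne_bot R.φ) hβ hm hnorm
    fun Q hQ hQ0 hdvd => classIn_tsupp₂_of_absNorm_dvd hq₁ hq₂ Q hQ hQ0 hdvd

/-- **An `ω`-type class certificate of an odd code.** [cite: Marcus2018, Ch. 5, Thm. 35] [cite: Cohen1993, §6.5] -/
theorem classIn_of_classRelW (hθ : aeval θ (MonicCubic.poly fd.base.a fd.base.b fd.base.c) = 0)
    (h3 : finrank ℚ K = 3) (h : fd.checkCoreD = true) {e : PrimeEntry} (hp : e.p.Prime)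
    (hrow : e.check fd.base.a fd.base.b fd.base.c = true) {C : PCode} (hC : C ∈ e.codes)
    (hq₁ : fd.base.q₁.Prime) (hq₂ : fd.base.q₂.Prime) {W : ℤ × ℤ × ℤ} {jk : ℕ}
    (hc : fd.classRelW C W jk = true) :
    ClassIn (tsuppClosure (((fd.base.q₁ * fd.base.q₂ : ℕ) : ℕ) : 𝓞 K)) (idealOf hθ C) := by
  simp only [classRelW, ClFieldCertEQ.classRelQ, Bool.and_eq_true, decide_eq_true_eq] at hc
  obtain ⟨⟨hcop, hmem⟩, hN⟩ := hc
  exact classIn_of_rel2Q (fd.irreducible_of_coreD h) hθ h3 hp hrow hC hq₁ hq₂ hcop hmem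
    (natCast_mul_omegaElt_avatarD hθ (fd.d_pos h) (fd.aeval_omega hθ h) W) hN

/-- **The classes of the ideals containing `q₁·q₂` generate the class group** (dyadic block + `α`-rows).
[cite: Marcus2018, Ch. 5, Cor. 2 to Thm. 35] [cite: Cohen1993, §6.5] -/
theorem closure_q2_eq_top_of_coreD (hθ : aeval θ (MonicCubic.poly fd.base.a fd.base.b fd.base.c) = 0)
    (h3 : finrank ℚ K = 3) (h : fd.checkCoreD = true) (hpr : fd.base.primeList.Forall Nat.Prime) :
    Subgroup.closure {cc : ClassGroup (𝓞 K) | ∃ (J : Ideal (𝓞 K)) (hJ : J ∈ (Ideal (𝓞 K))⁰),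
      (((fd.base.q₁ * fd.base.q₂ : ℕ) : ℕ) : 𝓞 K) ∈ J ∧ ClassGroup.mk0 ⟨J, hJ⟩ = cc} = ⊤ := by
  have hR := fd.checkReg_of_coreD h
  have hirr := fd.irreducible_of_coreD h
  have hirr' := fd.irreducibleW h
  have hω := fd.aeval_omega hθ h
  have hq₁ := fd.base.q₁_prime hpr
  have hq₂ := fd.base.q₂_prime hpr
  obtain ⟨R₁⟩ := fd.nonempty_rooted₁ hθ h3 h
  obtain ⟨R₂⟩ := fd.nonempty_rooted₂ hθ h3 h
  obtain ⟨R₃⟩ := fd.nonempty_rooted₃ hθ h3 h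
  obtain ⟨-, -, -, -, -, -, -, -, hc₁, hc₂, hc₃⟩ := fd.dyadic_of_coreD h
  have hS := fd.checkSweepD_of_coreD h
  simp only [checkSweepD, Bool.and_eq_true, decide_eq_true_eq, List.all_eq_true, List.mem_range,
    Bool.or_eq_true, beq_iff_eq, List.any_eq_true] at hS
  obtain ⟨⟨hd, hcov⟩, hcls⟩ := hS
  change tsuppClosure (((fd.base.q₁ * fd.base.q₂ : ℕ) : ℕ) : 𝓞 K) = ⊤
  refine eq_top_of_classIn_lt_gcd hirr hθ hirr' hω h3 (b := fd.base.bM) hd fun p hpb hp P hP hlt => ?_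
  have hpP : (p : 𝓞 K) ∈ P := sweep_natCast_mem p hP
  have hPr : P.IsPrime := hP.1
  rcases hcov p hpb with (((((hlt2 | hsf) | rfl) | rfl) | rfl) | ⟨e, he, hep⟩)
  · exact absurd hp.two_le (by omega)
  · rw [ClFieldCert.smallFactor_eq_false hp] at hsf; exact absurd hsf Bool.false_ne_true
  · -- `p = 2`: the dyadic block
    have hP0 : P ≠ ⊥ := by
      rintro rfl
      exact hp.ne_zero (by exact_mod_cast (Ideal.mem_bot.mp hpP : ((2 : ℕ) : 𝓞 K) = 0))
    let w : HeightOneSpectrum (𝓞 K) := ⟨P, hPr, hP0⟩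
    have hw : ((2 : ℕ) : 𝓞 K) ∈ w.asIdeal := hpP
    rcases (cover₂_of_coreD hθ h3 h R₁ R₂ R₃).2 w hw with hw₁ | hw₂ | hw₃
    · have : P = primeOf R₁.φ := congrArg HeightOneSpectrum.asIdeal hw₁
      rw [this]; exact classIn_of_dyClass hθ h3 h hpr R₁ hc₁
    · have : P = primeOf R₂.φ := congrArg HeightOneSpectrum.asIdeal hw₂
      rw [this]; exact classIn_of_dyClass hθ h3 h hpr R₂ hc₂
    · have : P = primeOf R₃.φ := congrArg HeightOneSpectrum.asIdeal hw₃
      rw [this]; exact classIn_of_dyClass hθ h3 h hpr R₃ hc₃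
  · refine ClassIn.of_le (tsuppClosure_le_mul_left fd.base.q₁ fd.base.q₂) ?_
    rcases fd.base.qcover₁_of_reg hθ h3 hR hpr P hPr hpP with h' | h' <;> rw [h']
    · exact classIn_tsupp_span_pair_self _ _
    · exact classIn_tsupp_span_pair_self _ _
  · refine ClassIn.of_le (tsuppClosure_le_mul_right fd.base.q₁ fd.base.q₂) ?_
    rcases fd.base.qcover₂_of_reg hθ h3 hR hpr P hPr hpP with h' | h' <;> rw [h']
    · exact classIn_tsupp_span_pair_self _ _
    · exact classIn_tsupp_span_pair_self _ _
  · subst hep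
    have hrow := (fd.base.row_check_of_mem_reg hR he).1
    have hp' := fd.base.prime_of_mem hpr he
    obtain ⟨C, hC, rfl⟩ := cover_of_check hirr hθ h3 hp' hrow P hPr hpP
    rcases hcls e he with hb | hall
    · exfalso
      refine not_pow_inertiaDeg_lt (mem_primesOver_of_check hirr hθ h3 hp' hrow hC)
        (absNorm_of_check hirr hθ h3 hp' hrow hC) ?_ hlt
      exact hb.trans (Nat.le_self_pow (ClFieldCert.codeDeg_pos C).ne' _)
    · rcases hall C hC with ⟨dd, -, hcc⟩ | ⟨ce, -, -, hce⟩
      · exact classIn_of_classCheck₂ hirr hθ h3 hp' hrow hC hq₁ hq₂ hcc hlt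
      · exact classIn_of_classRelW hθ h3 h hp' hrow hC hq₁ hq₂ hce

/-! ## The dyadic primes as height-one primes, membership of general `ω`-elements -/

/-- Membership `x ∈ Pᵢ` of an `ω`-element with a general multiplier `M` (`M·x = X(α)`, `omegaCheck`) from a root-view
certificate on `X`. [folklore] -/
theorem mem_rooted_of_memCheck (hθ : aeval θ (MonicCubic.poly fd.base.a fd.base.b fd.base.c) = 0)
    (h : fd.checkCoreD = true) {ra : ℤ} (R : RootedPrime θ 2 ra fd.N) {M : ℕ} {X W : ℤ × ℤ × ℤ}
    (hX : omegaCheck fd.u fd.d M X W = true) {v : ℕ} (hc : memCheck 2 ra fd.N (M : ℤ) v X.1 X.2.1 X.2.2 = true) :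
    omegaElt hθ (fd.aeval_omega hθ h) W ∈ R.spec.asIdeal :=
  R.mem hθ (intCast_mul_omegaElt hθ (fd.d_pos h) (fd.aeval_omega hθ h) hX) hc

/-- Non-membership `x ∉ Pᵢ` likewise. [folklore] -/
theorem not_mem_rooted_of_notMemCheck (hθ : aeval θ (MonicCubic.poly fd.base.a fd.base.b fd.base.c) = 0)
    (h : fd.checkCoreD = true) {ra : ℤ} (R : RootedPrime θ 2 ra fd.N) {M : ℕ} {X W : ℤ × ℤ × ℤ}
    (hX : omegaCheck fd.u fd.d M X W = true) {v : ℕ}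
    (hc : notMemCheck 2 ra fd.N (M : ℤ) v X.1 X.2.1 X.2.2 = true) :
    omegaElt hθ (fd.aeval_omega hθ h) W ∉ R.spec.asIdeal :=
  R.not_mem hθ (intCast_mul_omegaElt hθ (fd.d_pos h) (fd.aeval_omega hθ h) hX) hc

/-- `2 ∈ Pᵢ`. -/
theorem two_mem_rooted {ra : ℤ} {N : ℕ} (R : RootedPrime θ 2 ra N) : ((2 : ℕ) : 𝓞 K) ∈ R.spec.asIdeal :=
  R.natCast_mem

/-- `N(Pᵢ) = 2`. -/
theorem absNorm_rooted {ra : ℤ} {N : ℕ} (R : RootedPrime θ 2 ra N) : absNorm R.spec.asIdeal = 2 := R.absNorm_eq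

end ClFieldCertD

end Summit.BirchSwinnertonDyer.BirchSwinnertonDyer.Rank2Observatory.TwoDescCl
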